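import Summits.Ventures.PercRepro.AntipodalCone4

/-!
# `AP4 = SMC4`, and the barrier for Lemma B (p4, gen 10)

Two complements to `AntipodalCone4.lean`:

* **`AP4_iff_SMC4`** — the antipodal cone is typer-2's single-merge concavity cone `SMC4`
  (`SMC4.lean`): covering pairs are comparable pairs (`SMC4_of_AP4`), and a mixed second
  difference `mix4 A s t s' t'` over a rectangle of comparable pairs telescopes into the
  covering-step differences along two chains of at most three covers each — the rank of `Π₄`
  (`Chain3`, `chain3_of_mem_compPairs4` by `decide`; `mix4_nonpos`). Hence
  `SMC4Principle_holds_antipodal`: the `SMC4` principle of `Certify4.lean` re-proved by the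
  antipodal induction (no edge concavity, no `p`-derivative).
* **`not_AP4_of_le_A_c005`** — no antipodal-certified kernel lies entrywise below C-005's kernel
  (proofs/P4-BPRIME.md §4): three chain rectangles force `A(a|b|cd, a|bc|d) ≤ A(x₁, x₃) ≤ -1`
  and a fourth then needs `A(a|bcd, ⊥) ≥ 1`. With `AP4_iff_SMC4` this is the count-level twin of
  mine-1's Farkas certificate that C-005 has no degree-2 (single-merge concavity) certificate
  on `Π₄`: Lemma B (`crossCount ≤ topBotCount`) is not a consequence of the chain inequalities.
-/

namespace PercRepro

open Finset
/-! ### `AP4` is `SMC4`: the chain inequalities telescope into the covering-pair inequalities -/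

/-- The mixed second difference of a kernel over the rectangle `(s, t) × (s', t')`. -/
def mix4 (A : Matrix (Fin 15) (Fin 15) ℤ) (s t s' t' : Fin 15) : ℤ :=
  A s s' + A t t' - A s t' - A t s'

/-- Telescoping in the first coordinate. -/
theorem mix4_trans_left (A : Matrix (Fin 15) (Fin 15) ℤ) (s u t s' t' : Fin 15) :
    mix4 A s t s' t' = mix4 A s u s' t' + mix4 A u t s' t' := by
  unfold mix4; ring

/-- Telescoping in the second coordinate. -/
theorem mix4_trans_right (A : Matrix (Fin 15) (Fin 15) ℤ) (s t s' u' t' : Fin 15) :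
    mix4 A s t s' t' = mix4 A s t s' u' + mix4 A s t u' t' := by
  unfold mix4; ring

/-- `s ≤ t` through at most three covering steps (`singleMerges4`), the rank of `Π₄` being `3`. -/
def Chain3 (s t : Fin 15) : Prop :=
  s = t ∨ (s, t) ∈ singleMerges4 ∨ (∃ u, (s, u) ∈ singleMerges4 ∧ (u, t) ∈ singleMerges4) ∨
    ∃ u v, (s, u) ∈ singleMerges4 ∧ (u, v) ∈ singleMerges4 ∧ (v, t) ∈ singleMerges4

/-- `Chain3` is decidable. -/
instance : DecidableRel Chain3 := fun _ _ => by unfold Chain3; infer_instance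

set_option maxRecDepth 8000 in
/-- Every comparable pair of rows is a chain of at most three covering steps (60 cases). -/
theorem chain3_of_mem_compPairs4 : ∀ st ∈ compPairs4, Chain3 st.1 st.2 := by decide +kernel

set_option maxRecDepth 8000 in
/-- Covering pairs are comparable pairs. -/
theorem singleMerges4_subset_compPairs4 : singleMerges4 ⊆ compPairs4 := by decide +kernel

/-- An antipodal-certified kernel satisfies typer-2's `SMC4` (the covering-pair case). -/
theorem SMC4_of_AP4 {A : Matrix (Fin 15) (Fin 15) ℤ} (h : AP4 A) : SMC4 A :=
  ⟨h.1, fun st hst st' hst' => by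
    have := h.2 st (singleMerges4_subset_compPairs4 hst) st' (singleMerges4_subset_compPairs4 hst')
    omega⟩

/-- The mixed difference over a chain of covers on the left and one cover on the right is `≤ 0`
for an `SMC4` kernel. -/
theorem mix4_nonpos_left {A : Matrix (Fin 15) (Fin 15) ℤ} (hA : SMC4 A) {s t s' t' : Fin 15}
    (h : Chain3 s t) (h' : (s', t') ∈ singleMerges4) : mix4 A s t s' t' ≤ 0 := by
  have unit : ∀ {a b : Fin 15}, (a, b) ∈ singleMerges4 → mix4 A a b s' t' ≤ 0 := fun hab => by
    have := hA.2 _ hab _ h'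
    dsimp only at this
    unfold mix4; omega
  rcases h with rfl | h | ⟨u, h1, h2⟩ | ⟨u, v, h1, h2, h3⟩
  · unfold mix4; omega
  · exact unit h
  · rw [mix4_trans_left A s u t]
    exact add_nonpos (unit h1) (unit h2)
  · rw [mix4_trans_left A s u t, mix4_trans_left A u v t]
    exact add_nonpos (unit h1) (add_nonpos (unit h2) (unit h3))

/-- The mixed difference over two chains of covers is `≤ 0` for an `SMC4` kernel. -/
theorem mix4_nonpos {A : Matrix (Fin 15) (Fin 15) ℤ} (hA : SMC4 A) {s t s' t' : Fin 15}
    (h : Chain3 s t) (h' : Chain3 s' t') : mix4 A s t s' t' ≤ 0 := by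
  rcases h' with rfl | h' | ⟨u', h1, h2⟩ | ⟨u', v', h1, h2, h3⟩
  · unfold mix4; omega
  · exact mix4_nonpos_left hA h h'
  · rw [mix4_trans_right A s t s' u']
    exact add_nonpos (mix4_nonpos_left hA h h1) (mix4_nonpos_left hA h h2)
  · rw [mix4_trans_right A s t s' u', mix4_trans_right A s t u' v']
    exact add_nonpos (mix4_nonpos_left hA h h1)
      (add_nonpos (mix4_nonpos_left hA h h2) (mix4_nonpos_left hA h h3))

/-- An `SMC4` kernel is antipodal-certified: the rectangle inequality over comparable pairs is the
sum of the covering-step inequalities along two maximal chains. -/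
theorem AP4_of_SMC4 {A : Matrix (Fin 15) (Fin 15) ℤ} (hA : SMC4 A) : AP4 A :=
  ⟨hA.1, fun st hst st' hst' => by
    have := mix4_nonpos hA (chain3_of_mem_compPairs4 st hst) (chain3_of_mem_compPairs4 st' hst')
    unfold mix4 at this; omega⟩

/-- **`AP4 = SMC4`**: the antipodal cone is typer-2's single-merge concavity cone. -/
theorem AP4_iff_SMC4 (A : Matrix (Fin 15) (Fin 15) ℤ) : AP4 A ↔ SMC4 A :=
  ⟨SMC4_of_AP4, AP4_of_SMC4⟩

/-- The `SMC4` principle, re-proved by the antipodal induction. -/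
theorem SMC4Principle_holds_antipodal : SMC4Principle :=
  fun _ hA _ _ _ _ G p hp a b c d => G.quadForm4_nonneg_of_AP4 (AP4_of_SMC4 hA) p hp a b c d

/-! ### The barrier: no antipodal certificate dominates the kernel of Lemma B -/

set_option maxRecDepth 8000 in
/-- **No antipodal-certified kernel lies below C-005's kernel entrywise.** Any `AP4` kernel with
`A(x₁, x₃) ≤ -1` and no positive entry off `(⊥, ⊤)`, `(⊤, ⊥)` is impossible: three chain
inequalities force `A(ab|cd, a|bc|d) ≤ A(x₁, x₃)`, `A(a|b|cd, ad|bc) ≤ A(x₁, x₃)`, then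
`A(a|b|cd, a|bc|d) ≤ A(x₁, x₃) ≤ -1`, and the rectangle `a|b|cd ≤ a|bcd`, `⊥ ≤ a|bc|d` needs
`A(a|bcd, ⊥) ≥ 1`. So Lemma B (`crossCount ≤ topBotCount`) has no certificate in the cone — the
count-level twin of the Farkas certificate that C-005 has no degree-2 certificate on `Π₄`. -/
theorem not_AP4_of_le_A_c005 (A : Matrix (Fin 15) (Fin 15) ℤ) (hA : AP4 A)
    (hle : ∀ s t : Fin 15, A s t ≤ A_c005 s t) : False := by
  have hd := hA.1
  have hc := hA.2
  have h30 := hc (3, 0) (by decide) (3, 0) (by decide)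
  have h80 := hc (8, 0) (by decide) (8, 0) (by decide)
  have h100 := hc (10, 0) (by decide) (10, 0) (by decide)
  have h130 := hc (13, 0) (by decide) (13, 0) (by decide)
  have h1413 := hc (14, 13) (by decide) (14, 13) (by decide)
  have h109 := hc (10, 9) (by decide) (10, 9) (by decide)
  have r1 := hc (3, 0) (by decide) (10, 8) (by decide)
  have r2 := hc (13, 3) (by decide) (8, 0) (by decide)
  have r3 := hc (13, 3) (by decide) (10, 8) (by decide)
  have r4 := hc (13, 9) (by decide) (14, 10) (by decide)
  dsimp only at h30 h80 h100 h130 h1413 h109 r1 r2 r3 r4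
  have e38 : A 3 8 ≤ -1 := by have := hle 3 8; rwa [show A_c005 3 8 = -1 from by decide] at this
  have e03 : A 0 3 ≤ 0 := by have := hle 0 3; rwa [show A_c005 0 3 = 0 from by decide] at this
  have e30 : A 3 0 ≤ 0 := by have := hle 3 0; rwa [show A_c005 3 0 = 0 from by decide] at this
  have e08 : A 0 8 ≤ 0 := by have := hle 0 8; rwa [show A_c005 0 8 = 0 from by decide] at this
  have e80 : A 8 0 ≤ 0 := by have := hle 8 0; rwa [show A_c005 8 0 = 0 from by decide] at this
  have e010 : A 0 10 ≤ 0 := by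
    have := hle 0 10; rwa [show A_c005 0 10 = 0 from by decide] at this
  have e100 : A 10 0 ≤ 0 := by
    have := hle 10 0; rwa [show A_c005 10 0 = 0 from by decide] at this
  have e013 : A 0 13 ≤ 0 := by
    have := hle 0 13; rwa [show A_c005 0 13 = 0 from by decide] at this
  have e130 : A 13 0 ≤ 0 := by
    have := hle 13 0; rwa [show A_c005 13 0 = 0 from by decide] at this
  have e1413 : A 14 13 ≤ 0 := by
    have := hle 14 13; rwa [show A_c005 14 13 = 0 from by decide] at this
  have e1314 : A 13 14 ≤ 0 := by
    have := hle 13 14; rwa [show A_c005 13 14 = 0 from by decide] at this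
  have e109 : A 10 9 ≤ 0 := by
    have := hle 10 9; rwa [show A_c005 10 9 = 0 from by decide] at this
  have e910 : A 9 10 ≤ 0 := by
    have := hle 9 10; rwa [show A_c005 9 10 = 0 from by decide] at this
  have e914 : A 9 14 ≤ 0 := by
    have := hle 9 14; rwa [show A_c005 9 14 = 0 from by decide] at this
  have d0 := hd 0; have d3 := hd 3; have d8 := hd 8; have d10 := hd 10; have d13 := hd 13
  have d14 := hd 14; have d9 := hd 9
  omega


end PercRepro
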